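/-
Origin: expansion seat `planner-pub-hodgecm-pv02-g5-0`, handover #1 2026-08-18T08:21:10Z (`HOME/pub-hodgecm-pv02-g5/lean/Pv02g5/ArchAWeil.lean`, md5 f336deb8, 414 lines);
landed by the gen-7 packager in gate run 26 as `HodgeCM/PerL34/ArchAWeil.lean` (verbatim).
-/
/-
Origin: HOME/pub-hodgecm-pv02-g5/lean/Pv02g5/ArchAWeil.lean — session planner-pub-hodgecm-pv02-g5-0 (unit
pub-hodgecm-pv02-g5, DAG-NODE PROVER #02 gen 5; lineage pv02 = N27 `ArchA` (r19), `ArchAFock`/`ArchAFockModel` (r25)).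
Intended final place (packager's call): `HodgeCM/PerL34/ArchAWeil.lean`.
NEW, ADDITIVE LEAF; imports TREE modules only (`HodgeCM.PerL34.ArchA` pv02 r19, `HodgeCM.Automorphic.WeilThetaModel`
prl1-g4 r25) + Mathlib — NO import rewrite; nothing imports it.
KIND: KERNEL junction — nothing cited, nothing posited beyond the displayed variables; zero placeholders.
-/
import Summits.HodgeConjecture.HodgeCM.PerL34.ArchA
import Summits.HodgeConjecture.HodgeCM.Automorphic.WeilThetaModel
import Mathlib.MeasureTheory.Measure.Haar.Basic
import Mathlib.Topology.ContinuousMap.Compact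
import Mathlib.Topology.ContinuousMap.Algebra
import Mathlib.Topology.Algebra.ContinuousMonoidHom
import Mathlib.LinearAlgebra.Eigenspace.Basic

/-!
# N27 (PerL v5 Lemma 4.1(a)) over the WEIL THETA MODEL: `ThetaKernel` and `WeightAction` become theorems

DAG node N27 = PerL v5 Lemma 4.1(a) (tex ll. 480–482; proof ll. 493–496) is KERNEL-PROVED in
`HodgeCM.PerL34.ArchA` (`LineArchData.N27_of`, pv02, run 19) over posited line DATA `D : LineArchData`, from three
labelled inputs: `ThetaKernel` (DEFINITIONAL: `u ↦ θ_φ(·,u)` continuous on the compact `[U(W_i)]`, the characters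
continuous, and the translation law `θ_{ω(u)φ}(·,u') = θ_φ(·,u'u)`, tex ll. 262–266), `WeightAction` and
`WeightDecomposition` (PRINT, [BW] VIII 2.7/2.8).  GAPS.md `pv02g4-K1 (i)` records `ThetaKernel` as the last
non-PRINT leaf of N27.

prl1-g4's `HodgeCM.WeilThetaModel` (run 25) CONSTRUCTS, from a Weil datum [We64] with n° 39 / Théorème 6 BY NAME,
the continuity of the theta distribution and the class-U dual-pair splitting `s : G_U(𝔸) × U(W)(𝔸) →* Mp(𝕎)_𝔸`,
the theta kernels `θ_Φ ∈ C([G_U] × [U(W)], ℂ)` (`Φ ∈ 𝒮^κ`) and PROVES the structural laws `θ_cont` and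
`θ_omg : θ_{ω(h)Φ}(ξ, q) = θ_Φ(ξ, h⁻¹ • q)` (PerL v5 l. 414).

This file is the JUNCTION of the two, for ONE hermitian LINE `(W_i, μ_i)` — so `G = U(W_i)(𝔸) = U(1)(𝔸_L)` is
COMMUTATIVE (`[CommGroup G]`), `[U(W_i)] = G ⧸ Γ` and `[G_U] = GU ⧸ ΓU` are compact:

* §1 the KERNEL SIDE.  A Weil datum's `S(X_𝔸)` carries no linear structure in `Literature.Theta.WeilThetaDatum`
  (bare carriers), whereas N27's `LineArchData` is linear (`𝒮` a `ℂ`-module, `ω|_{U(W_{i,b})}` by linear maps,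
  `Θ` linear).  The linear shadow that IS available is the kernel side: `kerSpan M` := the `ℂ`-span of the kernels
  `θ_Φ`, `Φ ∈ 𝒮^κ`, inside `C([G_U] × [U(W_i)], ℂ)`, with `ω(h)` := right translation
  `(T_h F)(ξ, q) := F(ξ, h⁻¹ • q)` — on `kerSpan M` this is the linear action FORCED by equivariance of `Φ ↦ θ_Φ`
  (`transl_θ`, which is `θ_omg` read as `T_h θ_Φ = θ_{ω(h)Φ}`); `kerSpan M` is `T_h`-stable (`transl_mem_kerSpan`) and
  `omega M : G →* Module.End ℂ (kerSpan M)` is a genuine representation (`transl_one`, `transl_mul`).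
* §2 `du` := the Haar measure of the compact abelian group `[U(W_i)]` normalised to mass `1` (`probHaar`; right
  invariant because the group is abelian).
* §3 the LINE DATUM `lineData M ι₁ ι kJ : ArchA.LineArchData`: `Q := G ⧸ Γ`, `μ := probHaar Γ`,
  `toQ b := (G → G ⧸ Γ) ∘ ι_b` for the given real-place circles `ι_b : U(W_{i,b}) = U(1) →* U(W_i)(𝔸)`,
  `A := C([G_U], ℂ)` (sup norm — only its Banach-space structure is used by N27), `S := kerSpan M`,
  `ωb b := omega M ∘ ι_b`, `Θ F u := F(·, u⁻¹)` (`slice`; the `u⁻¹` converts Mathlib's coset convention of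
  `WeilThetaModel.θ` back to PerL's `θ_φ(·, u)`, see `Theta_θ_mk`), `piece b k :=` the joint `u ↦ u^k`-eigenspace of
  `U(W_{i,b})` on `S` ([BW] VIII 2.7: the weight spaces ARE the eigenspaces), `kJ` the [BW] weight names (data, as
  in `ArchA`), `X :=` the continuous unitary characters of `[U(W_i)]` (`ContinuousMonoidHom (G ⧸ Γ) Circle`).
* §4 THEOREMS: **`thetaKernel : (lineData M ι₁ ι kJ).ThetaKernel`** — (i) `u ↦ θ_F(·,u)` continuous, by currying
  a continuous kernel on `[G_U] × [U(W_i)]`; (ii) characters continuous, by definition of `X`; (iii) the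
  translation law, from `θ_omg` and the identity `h⁻¹ • q⁻¹ = (q·h̄)⁻¹` in `G ⧸ Γ` (`inv_smul_inv`);
  **`weightAction : (lineData M ι₁ ι kJ).WeightAction`** (by definition of the eigenspaces); hence
  **`N27_ofWeil (hD : WeightDecomposition) : (lineData M ι₁ ι kJ).N27_statement`** := pv02's `N27_of` with TWO of
  its three inputs DISCHARGED, and the equivariance `lift_act_ofWeil` (tex l. 493,
  `θ(ω(u)φ,χ') = χ'(u)⁻¹ θ(φ,χ')`) hypothesis-free; `weightDecomposition_of_generators` /
  `weightDecomposition_of_kernel` reduce the third input to the generators, i.e. to the MODEL-level PRINT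
  statement `KernelWeightDecomposition M ι`, whence the NET FORM
  **`N27_ofWeilModel (h : KernelWeightDecomposition M ι) : (lineData M ι₁ ι kJ).N27_statement`**.

RESIDUAL of N27 over this model = ONE PRINT input, `KernelWeightDecomposition M ι` (every kernel `θ_Φ`,
`Φ ∈ 𝒮^κ`, is a finite sum of `U(W_{i,b})`-weight kernels at each real place `b`: `𝒮^κ = pr_κ(𝒫)` consists of
`K_∞`-finite, in particular `U(W_{i,b})(ℝ) = U(1)`-finite, vectors — [BW] VIII 2.7(1)/2.8(1)/2.10(1), PDF p0197;
transferred to kernels by the equivariance `transl_θ`), plus the model `M` itself (prl1-g4's labels: [P] `act_one`, [DEF+P]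
`theta_act`, [PRINT BY NAME] n° 39 / Théorème 6, [PRINT-DERIVED] `dist_cont`, [class U] `s`, `s_cont`, `s_rat`,
[DEF] `SK`, `SK_stable`) and the DATA `ι` (real-place circles) and `kJ` ([BW] weight names).

RENDERING NOTE.  N27's `𝒮` is instantiated by its image under the equivariant map `Φ ↦ θ_Φ`: Lemma 4.1(a) factors
through `θ` (the lift `θ(φ, χ')` and the vanishing conditions only see `θ_φ`), and under the PRINT input the
`U(W_{i,b})`-weight spaces of `𝒮^κ` map ONTO those of `kerSpan M` (eigenspaces for distinct characters are
independent), so `HasArchJ` / `LocMatches` / `N27_statement` of the line datum are PerL's (a) read on kernels.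
VACUITY NOTE.  The hypotheses are instances (`CommGroup G`, compactness of the two quotients, a Borel structure on
`G ⧸ Γ`) and the model `M` (prl1-g4's structure; its inhabitation is the model-builders' business, not assumed
here); relative to `M` the only Prop hypothesis, `KernelWeightDecomposition M ι` (resp. `WeightDecomposition`), is
satisfiable (trivially when `𝒮^κ = ∅`, `kerSpan = ⊥`) and holds in the intended model (above).  CONVENTION CHECK
(the point of a kernel junction): N27's law `Θ (ω(u)φ) u' = Θ φ (u'·u)` (tex l. 262: `θ_φ(g,u) = Σ_x ω(g,u)φ(x)`,
so `θ_{ω(u)φ}(g,u') = θ_φ(g,u'u)`) and prl1-g4's `θ_omg` (coset convention, `h⁻¹ •`) AGREE under `u ↦ u⁻¹` in the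
second variable — proved, not asserted (`thetaKernel`, conjunct (iii)).
-/

set_option autoImplicit false

noncomputable section

open MeasureTheory Topology

attribute [-instance] Quotient.instMeasurableSpace

namespace HodgeCM
namespace PerL34
namespace ArchAWeil

open ArchA

/-! ## 1. The kernel side: translation action, slices, the span of the theta kernels -/

section Transl

variable {GU : Type} [Group GU] [TopologicalSpace GU] {ΓU : Subgroup GU}
variable {G : Type} [CommGroup G] [TopologicalSpace G] [IsTopologicalGroup G] {Γ : Subgroup G}

/-- Right translation in the `[U(W_i)]`-variable as a continuous self-map of `[G_U] × [U(W_i)]`: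
`τ_h(ξ, q) = (ξ, h⁻¹ • q)`. -/
def transMap (h : G) : C((GU ⧸ ΓU) × (G ⧸ Γ), (GU ⧸ ΓU) × (G ⧸ Γ)) :=
  ContinuousMap.prodMk ContinuousMap.fst
    ⟨fun p => h⁻¹ • p.2, (continuous_const_smul h⁻¹).comp continuous_snd⟩

/-- (Ported verbatim from the HodgeCMPerL package; no docstring in the source.) -/
@[simp] theorem transMap_apply (h : G) (p : (GU ⧸ ΓU) × (G ⧸ Γ)) :
    transMap (ΓU := ΓU) (Γ := Γ) h p = (p.1, h⁻¹ • p.2) := rfl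

/-- **`ω(h)` on kernels**: `(T_h F)(ξ, q) := F(ξ, h⁻¹ • q)`, a `ℂ`-linear self-map of `C([G_U] × [U(W_i)], ℂ)`. -/
def transl (h : G) : C((GU ⧸ ΓU) × (G ⧸ Γ), ℂ) →ₗ[ℂ] C((GU ⧸ ΓU) × (G ⧸ Γ), ℂ) where
  toFun F := F.comp (transMap h)
  map_add' F F' := by ext; rfl
  map_smul' c F := by ext; rfl

/-- (Ported verbatim from the HodgeCMPerL package; no docstring in the source.) -/
@[simp] theorem transl_apply (h : G) (F : C((GU ⧸ ΓU) × (G ⧸ Γ), ℂ)) (p : (GU ⧸ ΓU) × (G ⧸ Γ)) :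
    transl (ΓU := ΓU) (Γ := Γ) h F p = F (p.1, h⁻¹ • p.2) := rfl

/-- (Ported verbatim from the HodgeCMPerL package; no docstring in the source.) -/
theorem transl_one (F : C((GU ⧸ ΓU) × (G ⧸ Γ), ℂ)) : transl (ΓU := ΓU) (Γ := Γ) (1 : G) F = F := by
  ext p
  rw [transl_apply, inv_one, one_smul]

/-- (Ported verbatim from the HodgeCMPerL package; no docstring in the source.) -/
theorem transl_mul (h h' : G) (F : C((GU ⧸ ΓU) × (G ⧸ Γ), ℂ)) :
    transl (ΓU := ΓU) (Γ := Γ) (h * h') F = transl h (transl h' F) := by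
  ext p
  rw [transl_apply, transl_apply, transl_apply, mul_inv_rev, mul_smul]

end Transl

section Slice

variable {GU : Type} [Group GU] [TopologicalSpace GU] {ΓU : Subgroup GU}
variable {G : Type} [CommGroup G] [TopologicalSpace G] {Γ : Subgroup G}

/-- Slicing a kernel at `q ∈ [U(W_i)]`: `F(·, q) ∈ C([G_U], ℂ)` (Mathlib's `ContinuousMap.curry` after a swap). -/
def slice (F : C((GU ⧸ ΓU) × (G ⧸ Γ), ℂ)) (q : G ⧸ Γ) : C(GU ⧸ ΓU, ℂ) :=
  (F.comp ContinuousMap.prodSwap).curry q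

/-- (Ported verbatim from the HodgeCMPerL package; no docstring in the source.) -/
@[simp] theorem slice_apply (F : C((GU ⧸ ΓU) × (G ⧸ Γ), ℂ)) (q : G ⧸ Γ) (ξ : GU ⧸ ΓU) :
    slice F q ξ = F (ξ, q) := rfl

/-- `q ↦ F(·, q)` is continuous into `C([G_U], ℂ)` (compact-open topology; on a compact `[G_U]` it is the
uniform = sup-norm topology, by Mathlib's construction of the metric on `C(α, β)`). -/
theorem continuous_slice (F : C((GU ⧸ ΓU) × (G ⧸ Γ), ℂ)) : Continuous (slice F) :=
  (F.comp ContinuousMap.prodSwap).curry.continuous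

/-- (Ported verbatim from the HodgeCMPerL package; no docstring in the source.) -/
theorem slice_add (F F' : C((GU ⧸ ΓU) × (G ⧸ Γ), ℂ)) (q : G ⧸ Γ) :
    slice (F + F') q = slice F q + slice F' q := by
  ext; rfl

/-- (Ported verbatim from the HodgeCMPerL package; no docstring in the source.) -/
theorem slice_smul (c : ℂ) (F : C((GU ⧸ ΓU) × (G ⧸ Γ), ℂ)) (q : G ⧸ Γ) :
    slice (c • F) q = c • slice F q := by
  ext; rfl

end Slice

section Coset

variable {G : Type} [CommGroup G] {Γ : Subgroup G}

/-- The coset identity behind the translation law: `h⁻¹ • q⁻¹ = (q · h̄)⁻¹` in `G ⧸ Γ`. -/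
theorem inv_smul_inv (h : G) (q : G ⧸ Γ) : h⁻¹ • q⁻¹ = (q * (h : G ⧸ Γ))⁻¹ := by
  induction q using QuotientGroup.induction_on with
  | H y =>
    rw [← QuotientGroup.mk_inv, MulAction.Quotient.smul_mk, smul_eq_mul, ← QuotientGroup.mk_mul,
      ← QuotientGroup.mk_inv, mul_inv_rev]

end Coset

section KerSpan

variable {GU : Type} [Group GU] [TopologicalSpace GU] [IsTopologicalGroup GU] {ΓU : Subgroup GU}
variable {G : Type} [CommGroup G] [TopologicalSpace G] [IsTopologicalGroup G] {Γ : Subgroup G}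
variable (M : WeilThetaModel GU ΓU G Γ)

/-- `θ_omg` (prl1-g4, PerL v5 l. 414) in operator form: **`T_h θ_Φ = θ_{ω(h)Φ}`** — the translation action is
the one making `Φ ↦ θ_Φ` equivariant. -/
theorem transl_θ (h : G) (Φ : M.SK) : transl h (M.θ Φ) = M.θ (M.omg h Φ) := by
  ext ⟨ξ, q⟩
  rw [transl_apply]
  exact (M.θ_omg h Φ ξ q).symm

/-- **The kernel-side `𝒮`**: the `ℂ`-span of the theta kernels `θ_Φ`, `Φ ∈ 𝒮^κ`, in `C([G_U] × [U(W_i)], ℂ)`. -/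
def kerSpan : Submodule ℂ C((GU ⧸ ΓU) × (G ⧸ Γ), ℂ) :=
  Submodule.span ℂ (Set.range M.θ)

/-- (Ported verbatim from the HodgeCMPerL package; no docstring in the source.) -/
theorem θ_mem_kerSpan (Φ : M.SK) : M.θ Φ ∈ kerSpan M :=
  Submodule.subset_span ⟨Φ, rfl⟩

/-- `kerSpan M` is stable under every `T_h`, `h ∈ U(W_i)(𝔸)` (from `transl_θ` and `SK_stable`). -/
theorem transl_mem_kerSpan (h : G) {F : C((GU ⧸ ΓU) × (G ⧸ Γ), ℂ)} (hF : F ∈ kerSpan M) :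
    transl h F ∈ kerSpan M := by
  have hle : Submodule.map (transl h) (kerSpan M) ≤ kerSpan M := by
    rw [kerSpan, Submodule.map_span_le]
    rintro _ ⟨Φ, rfl⟩
    rw [transl_θ]
    exact θ_mem_kerSpan M _
  exact hle (Submodule.mem_map_of_mem hF)

/-- **The Weil action on the kernel-side `𝒮`** as a representation `U(W_i)(𝔸) →* End_ℂ(kerSpan M)`. -/
def omega : G →* Module.End ℂ (kerSpan M) where
  toFun h := (transl h).restrict fun F hF => transl_mem_kerSpan M h hF
  map_one' := by
    refine LinearMap.ext fun F => Subtype.ext ?_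
    rw [LinearMap.coe_restrict_apply, Module.End.one_apply, transl_one]
  map_mul' h h' := by
    refine LinearMap.ext fun F => Subtype.ext ?_
    rw [LinearMap.coe_restrict_apply, Module.End.mul_apply, LinearMap.coe_restrict_apply,
      LinearMap.coe_restrict_apply, transl_mul]

/-- (Ported verbatim from the HodgeCMPerL package; no docstring in the source.) -/
@[simp] theorem coe_omega_apply (h : G) (F : kerSpan M) :
    ((omega M h F : kerSpan M) : C((GU ⧸ ΓU) × (G ⧸ Γ), ℂ)) = transl h (F : C((GU ⧸ ΓU) × (G ⧸ Γ), ℂ)) :=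
  rfl

/-- **`Θ` of N27 on the kernel side**: `F ↦ (u ↦ F(·, u⁻¹))`, linear in `F`. -/
def Theta : kerSpan M →ₗ[ℂ] (G ⧸ Γ → C(GU ⧸ ΓU, ℂ)) where
  toFun F q := slice (F : C((GU ⧸ ΓU) × (G ⧸ Γ), ℂ)) q⁻¹
  map_add' F F' := by
    funext q
    simp only [Pi.add_apply, Submodule.coe_add, slice_add]
  map_smul' c F := by
    funext q
    simp only [Pi.smul_apply, RingHom.id_apply, Submodule.coe_smul, slice_smul]

/-- (Ported verbatim from the HodgeCMPerL package; no docstring in the source.) -/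
@[simp] theorem Theta_apply (F : kerSpan M) (q : G ⧸ Γ) :
    Theta M F q = slice (F : C((GU ⧸ ΓU) × (G ⧸ Γ), ℂ)) q⁻¹ := rfl

/-- (Ported verbatim from the HodgeCMPerL package; no docstring in the source.) -/
theorem continuous_Theta (F : kerSpan M) : Continuous (Theta M F) :=
  (continuous_slice (F : C((GU ⧸ ΓU) × (G ⧸ Γ), ℂ))).comp continuous_inv

/-- The translation law on the kernel side: `Θ (ω(h)F) q = Θ F (q · h̄)`. -/
theorem Theta_omega (h : G) (F : kerSpan M) (q : G ⧸ Γ) :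
    Theta M (omega M h F) q = Theta M F (q * (h : G ⧸ Γ)) := by
  ext ξ
  rw [Theta_apply, Theta_apply, coe_omega_apply, slice_apply, slice_apply, transl_apply, inv_smul_inv]

/-- `Θ` on a theta kernel, on representatives: `Θ θ_Φ (ȳ) (x̄) = θ_Φ(x̄, ȳ⁻¹) = Θ_Φ(s(x, y⁻¹)⁻¹) = Θ_Φ(s(x⁻¹, y))`
— Weil's theta series of `Φ` at the splitting of `(x⁻¹, y)`: PerL's `θ_φ(·, u)` in the `u`-variable
(`x ↦ x⁻¹` is the fixed passage between the left- and right-coset conventions for `[G_U]`). -/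
theorem Theta_θ_mk (Φ : M.SK) (x : GU) (y : G) :
    Theta M ⟨M.θ Φ, θ_mem_kerSpan M Φ⟩ (y : G ⧸ Γ) (x : GU ⧸ ΓU) = M.W.theta Φ.1 (M.s (x⁻¹, y)) := by
  rw [Theta_apply, slice_apply, ← QuotientGroup.mk_inv, WeilThetaModel.θ_mk, Prod.inv_mk, inv_inv]

variable {RealPl : Type} (ι : RealPl → (Circle →* G))

/-- **The one PRINT input left, stated on the MODEL** ([BW] VIII 2.7(1) / 2.8(1) / 2.10(1), PDF p0197, for
`𝒮^κ = pr_κ(𝒫)`: every `Φ ∈ 𝒮^κ` is a finite sum of `U(W_{i,b})(ℝ) = U(1)`-eigenvectors `Ψ_j ∈ 𝒮^κ`,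
`ω(ι_b(u))Ψ_j = u^{k_j} Ψ_j`, at each real place `b`) — read through the kernels, the only linear shadow of the bare
carrier `S(X_𝔸)`: `θ_Φ = Σ_j θ_{Ψ_j}` with `θ_{ω(ι_b u)Ψ_j} = u^{k_j} θ_{Ψ_j}`. -/
def KernelWeightDecomposition : Prop :=
  ∀ (b : RealPl) (Φ : M.SK), ∃ (n : ℕ) (Ψ : Fin n → M.SK) (k : Fin n → ℤ),
    M.θ Φ = ∑ j, M.θ (Ψ j) ∧ ∀ j (u : Circle), M.θ (M.omg (ι b u) (Ψ j)) = ((u : ℂ) ^ k j) • M.θ (Ψ j)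

end KerSpan

/-! ## 2. The Haar probability measure `du` on the compact abelian group `[U(W_i)]` -/

section Haar

variable {G : Type} [CommGroup G] [TopologicalSpace G] [IsTopologicalGroup G] (Γ : Subgroup G)
variable [CompactSpace (G ⧸ Γ)] [MeasurableSpace (G ⧸ Γ)] [BorelSpace (G ⧸ Γ)]

/-- `du` on `[U(W_i)] = G ⧸ Γ`: the Haar measure normalised by `vol [U(W_i)] = 1` (tex l. 266). -/
def probHaar : Measure (G ⧸ Γ) := Measure.haarMeasure ⊤

/-- (Ported verbatim from the HodgeCMPerL package; no docstring in the source.) -/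
instance isHaarMeasure_probHaar : (probHaar Γ).IsHaarMeasure := by
  unfold probHaar; infer_instance

/-- (Ported verbatim from the HodgeCMPerL package; no docstring in the source.) -/
instance isProbabilityMeasure_probHaar : IsProbabilityMeasure (probHaar Γ) := by
  refine ⟨?_⟩
  have h := Measure.haarMeasure_self (G := G ⧸ Γ) (K₀ := ⊤)
  rwa [TopologicalSpace.PositiveCompacts.coe_top] at h

/-- (Ported verbatim from the HodgeCMPerL package; no docstring in the source.) -/
instance isMulLeftInvariant_probHaar : (probHaar Γ).IsMulLeftInvariant := inferInstance

/-- Right invariance: `[U(W_i)]` is abelian. -/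
instance isMulRightInvariant_probHaar : (probHaar Γ).IsMulRightInvariant := inferInstance

end Haar

/-! ## 3. The line datum of N27 over the Weil theta model -/

section LineDatum

variable {GU : Type} [Group GU] [TopologicalSpace GU] [IsTopologicalGroup GU] {ΓU : Subgroup GU}
variable {G : Type} [CommGroup G] [TopologicalSpace G] [IsTopologicalGroup G] {Γ : Subgroup G}
variable [CompactSpace (GU ⧸ ΓU)] [CompactSpace (G ⧸ Γ)] [MeasurableSpace (G ⧸ Γ)] [BorelSpace (G ⧸ Γ)]
variable (M : WeilThetaModel GU ΓU G Γ) {RealPl : Type} (ι₁ : RealPl) (ι : RealPl → (Circle →* G))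
  (kJ : RealPl → ℤ)

/-- **The N27 line datum over the Weil theta model** (one hermitian line `(W_i, μ_i)`): see the module docstring,
§3, for the dictionary field by field.  (`abbrev`: the fields must unfold for instance search downstream.) -/
abbrev lineData : LineArchData where
  RealPl := RealPl
  ι₁ := ι₁
  Q := G ⧸ Γ
  μ := probHaar Γ
  toQ b := (QuotientGroup.mk' Γ).comp (ι b)
  A := C(GU ⧸ ΓU, ℂ)
  S := kerSpan M
  ωb b := (omega M).comp (ι b)
  Θ := Theta M
  piece b k := ⨅ u : Circle, Module.End.eigenspace ((omega M).comp (ι b) u) ((u : ℂ) ^ k)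
  kJ := kJ
  X := ContinuousMonoidHom (G ⧸ Γ) Circle
  χQ χ := χ.toMonoidHom

/-! ### The dictionary, field by field (all `rfl`) -/

/-- (Ported verbatim from the HodgeCMPerL package; no docstring in the source.) -/
theorem lineData_Q : (lineData M ι₁ ι kJ).Q = (G ⧸ Γ) := rfl

/-- (Ported verbatim from the HodgeCMPerL package; no docstring in the source.) -/
theorem lineData_μ : (lineData M ι₁ ι kJ).μ = probHaar Γ := rfl

/-- (Ported verbatim from the HodgeCMPerL package; no docstring in the source.) -/
theorem lineData_S : (lineData M ι₁ ι kJ).S = kerSpan M := rfl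

/-- (Ported verbatim from the HodgeCMPerL package; no docstring in the source.) -/
theorem lineData_A : (lineData M ι₁ ι kJ).A = C(GU ⧸ ΓU, ℂ) := rfl

/-- (Ported verbatim from the HodgeCMPerL package; no docstring in the source.) -/
theorem lineData_e (b : RealPl) : (lineData M ι₁ ι kJ).e b = - kJ b := rfl

/-- (Ported verbatim from the HodgeCMPerL package; no docstring in the source.) -/
theorem lineData_toQ (b : RealPl) (u : Circle) : (lineData M ι₁ ι kJ).toQ b u = ((ι b u : G) : G ⧸ Γ) := rfl

/-- (Ported verbatim from the HodgeCMPerL package; no docstring in the source.) -/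
theorem lineData_Θ (F : kerSpan M) (q : G ⧸ Γ) :
    (lineData M ι₁ ι kJ).Θ F q = slice (F : C((GU ⧸ ΓU) × (G ⧸ Γ), ℂ)) q⁻¹ := rfl

/-- (Ported verbatim from the HodgeCMPerL package; no docstring in the source.) -/
theorem lineData_ωb (b : RealPl) (u : Circle) (F : kerSpan M) :
    (lineData M ι₁ ι kJ).ωb b u F = omega M (ι b u) F := rfl

/-- (Ported verbatim from the HodgeCMPerL package; no docstring in the source.) -/
theorem lineData_loc (χ : ContinuousMonoidHom (G ⧸ Γ) Circle) (b : RealPl) (u : Circle) :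
    (lineData M ι₁ ι kJ).loc χ b u = χ ((ι b u : G) : G ⧸ Γ) := rfl

/-- The theta lift of N27 in this model: `θ(F, χ') = ∫_{[U(W_i)]} χ'(u) F(·, u⁻¹) du`. -/
theorem lineData_lift (χ : ContinuousMonoidHom (G ⧸ Γ) Circle) (F : kerSpan M) :
    (lineData M ι₁ ι kJ).lift χ F =
      ∫ q, ((χ q : Circle) : ℂ) • slice (F : C((GU ⧸ ΓU) × (G ⧸ Γ), ℂ)) q⁻¹ ∂(probHaar Γ) := rfl

/-! ## 4. The theorems: `ThetaKernel`, `WeightAction`, N27 -/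

/-- **`ThetaKernel` is a THEOREM of the Weil theta model** (GAPS pv02g4-K1 (i) discharged over the model):
(i) `u ↦ θ_F(·, u)` is continuous on `[U(W_i)]`; (ii) the characters are continuous; (iii) the translation law
`Θ (ω(u)F) u' = Θ F (u'·u)` for `u ∈ U(W_{i,b})`. -/
theorem thetaKernel : (lineData M ι₁ ι kJ).ThetaKernel :=
  ⟨fun F => continuous_Theta M F, fun χ => χ.continuous_toFun, fun b u F q => Theta_omega M (ι b u) F q⟩

/-- **`WeightAction` is a THEOREM** here: the weight spaces are DEFINED as the joint `u ↦ u^k`-eigenspaces of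
`U(W_{i,b})` ([BW] VIII 2.7). -/
theorem weightAction : (lineData M ι₁ ι kJ).WeightAction := fun _ _ u _ hF =>
  Module.End.mem_eigenspace_iff.mp ((Submodule.mem_iInf _).mp hF u)


-- port_pkg: scope closed for this part
end LineDatum
end ArchAWeil
end PerL34
end HodgeCM
end
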